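import Literature.Computability.FineGrained.EditDistanceSETH
import Literature.Computability.FineGrained.SplitAndListOV
import Literature.Computability.Cryptography.FGComplexityProofs
import HarnessLib

/-!
# Same-exponent transfer along a one-query word-RAM reduction from Orthogonal Vectors

The last, machine-level step of the reductions "Orthogonal Vectors → similarity measure `δ`" of
K. Bringmann, M. Künnemann, *Quadratic conditional lower bounds for string problems and dynamic
time warping*, FOCS 2015 (arXiv:1502.01063), Thm. 3.3, proof in §3.1 ("for `n = m` we can compute
`δ(x, y)` in time `O(((n+m)d)^{2-ε}) = O((nd)^{2-ε})`, contradicting OVH"), and of A. Backurs,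
P. Indyk, STOC 2015 (arXiv:1412.0348), Thm. 3 ("If `EDIT` can be computed in time `O(n^{2-δ})` …
then OV … can be solved in time `d^{O(1)} · N^{2-δ}`"): the exponent `2 - ε` of the hypothetical
algorithm for `δ` is **kept** for OV, with the polynomial dimension factor `(d+1)²`.

In the word-RAM model of this library (`Cryptography.WordRAM`, `Cryptography.FGProblem`) the
reduction is a deterministic oracle program `M` that, on the encoding of an OV instance
`I = (n, d, A, B)`, runs for `O((n+1)(d+1))` steps, asks **at most one** query — the encoding of a
`B`-instance of size and length `O((n+1)(d+1))` — and outputs OV's answer; the algorithm for OV is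
the simulating machine `WordRAM.Inline.SIM M k M_B k_B` of
`Literature.Computability.Cryptography.WordRAMInline3`, which answers the query by an inline run of
the hypothetical algorithm `M_B` at the query's own word size. Its cost
(`WordRAM.Inline.simCost`) is linear in the reduction's time, the query length and the inline
running time `⌊C m^{2-ε} + C⌋₊`, `m = O((n+1)(d+1))`, plus `O(log W)` for the one query, hence
`O(((n+1)(d+1))^{2-ε}) ≤ O((n+1)^{2-ε} (d+1)²)` — the same `ε`.

* `inTimeInst_rpow_of_oneQueryReduction`: the transfer for an arbitrary source problem `A` with a
  size measure `sz ≥ 1` that fits in a word, input length and width `O(sz)`, bounded output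
  lengths on both sides, and any exponent `e ≥ 1` (so that the linear overhead is `O(sz^e)`):
  `B ∈ TIME(O(m^e))` gives `A ∈ TIME(⌊C · sz^e⌋₊)`.
* `ovInTimePolyDim_of_oneQueryReduction`: the instance `A = OV`, `sz = (n+1)(d+1)`, `e = 2 - ε`
  (`ε ≤ 1`): the conclusion is `OVInTimePolyDim ε` of
  `Literature.Computability.FineGrained.EditDistanceSETH` (dimension exponent `c = 2`).

Contrast: the generic transfer property `FGReducible.trulySubTime_of_sizeFitsWord_holds`
(`…Cryptography.FGComplexityProofs`; VVW ICM 2018, remark after Def. 2.1) only yields *some*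
saving `ε' > 0` for `A` from a saving `ε` for `B` (its per-instance bound `sim_instance` charges
`O(log W)` per unit of budget), which suffices for OVH-hardness statements
(`not_lcs_inTimeO_of_ovhWordRAM` in `…FineGrained.LCSFromOVReduction`) but not for the printed
same-exponent form of BI15 Thm. 3 / BK15 Thm. 3.3 (the named fact
`ovInTimePolyDim_of_editDistance_inTimeO`, and `DTWRed.ovInTimePolyDim_of_dtw_inTimeO`).

## References

* K. Bringmann, M. Künnemann, FOCS 2015, Thm. 3.3 (proof, §3.1), §2.1 (OVH).
* A. Backurs, P. Indyk, STOC 2015, Thm. 3.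
* V. Vassilevska Williams, *On some fine-grained questions in algorithms and complexity*,
  Proc. ICM 2018, §2 (the word RAM; Def. 2.1 and the remark following it).
-/

namespace Literature.Computability.FineGrained

open Cryptography Cryptography.WordRAM FGProblem

/-! ### The generic one-query transfer -/

/-- **Same-exponent transfer along a one-query reduction.** Let `M` be a deterministic oracle
program which, for every oracle `O` answering `B`, halts on the encoding of every instance `x` of
`A` within `K · sz x` steps (word size `k · width x`) with an accepted output, having asked at
most one query, the encoding of a `B`-instance of size `≤ K · sz x` and length `≤ K · sz x`; let
the size measure `sz ≥ 1` satisfy `sz x < 2 ^ (K · width x)`, `|encode x| ≤ K · sz x`,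
`width x ≤ K · sz x`, and let accepted outputs of `A` and `B` have length `≤ K`. If `B` is
solvable in deterministic word-RAM time `O(m ^ e)` for an exponent `e ≥ 1`, then `A` is solvable
within `⌊C · (sz x) ^ e⌋₊` steps for some constant `C` — by the simulating machine
`WordRAM.Inline.SIM` (the reduction with the one oracle call answered by an inline run of `B`'s
algorithm). This is the accounting "`O(((n+m)d)^{2-ε})`" of Bringmann–Künnemann, FOCS 2015,
proof of Thm. 3.3, on the word RAM. [cite: BringmannKunnemannFOCS2015, Thm. 3.3 (proof, §3.1)] -/
theorem inTimeInst_rpow_of_oneQueryReduction {A B : FGProblem} {M : Program} {k K : ℕ}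
    (sz : A.Inst → ℕ) (hdet : M.IsDeterministic) (hsz : ∀ x, 1 ≤ sz x)
    (hfit : ∀ x, sz x < 2 ^ (K * A.width x))
    (hL : ∀ x, (A.encode x).length ≤ K * sz x) (hwd : ∀ x, A.width x ≤ K * sz x)
    (hAout : ∀ x, ∀ out ∈ A.Good x, out.length ≤ K)
    (hBout : ∀ y, ∀ out ∈ B.Good y, out.length ≤ K)
    (hred : ∀ O : List ℕ → List ℕ, B.OracleAnswers O → ∀ x : A.Inst,
      ∃ (c : Cfg) (t : ℕ), HaltsWithin M (k * A.width x) O zeroCoins (A.encode x) t c ∧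
        t ≤ K * sz x ∧ readOut c.mem ∈ A.Good x ∧ c.queries.length ≤ 1 ∧
        ∀ q ∈ c.queries, ∃ y : B.Inst, q = B.encode y ∧ B.size y ≤ K * sz x ∧
          q.length ≤ K * sz x)
    {e : ℝ} (he : 1 ≤ e) (hB : B.InTimeO fun m => (m : ℝ) ^ e) :
    ∃ C : ℝ, A.InTimeInst fun x => ⌊C * (sz x : ℝ) ^ e⌋₊ := by
  classical
  -- `B`'s algorithm and the oracle it computes
  obtain ⟨CB, MB, kB, hBdet, hBof, hMBrun⟩ := hB
  obtain ⟨O, s, hOans, hOs⟩ := exists_oracle_of_algorithm hMBrun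
  beta_reduce at hOs
  -- the constants of the simulating machine
  obtain ⟨G, hG⟩ : ∃ G : ℕ, G = Nat.size K + K := ⟨_, rfl⟩
  obtain ⟨c₁, hc₁⟩ : ∃ c₁ : ℕ, c₁ = G + K + k + Program.maxConst M + 2 := ⟨_, rfl⟩
  obtain ⟨k', hk'⟩ : ∃ k' : ℕ, k' = kB * c₁ + Program.maxConst MB + c₁ + G + 11 := ⟨_, rfl⟩
  set CB' : ℝ := max CB 0 with hCB'
  have hCB'0 : 0 ≤ CB' := le_max_right _ _
  obtain ⟨Γ, hΓ⟩ : ∃ Γ : ℝ,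
      Γ = 100 * K + 40 * ((k' : ℝ) * K) + 38 * (CB' * ((K : ℝ) ^ e + 1)) + 692 := ⟨_, rfl⟩
  refine ⟨Γ, Inline.SIM M k MB kB, k', Inline.SIM_isDeterministic M k MB kB,
    Inline.SIM_isOracleFree M k MB kB, fun x => ?_⟩
  obtain ⟨c, t, hHalt, ht, hgood, hqlen, hqs⟩ := hred O hOans x
  refine ⟨readOut c.mem, hgood, ?_⟩
  -- the numeric side conditions of the simulation
  set w := A.width x with hwdef
  have hw1 : 1 ≤ w := A.width_pos x
  have htG : t ≤ 2 ^ (G * w) := by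
    have h1 : sz x < 2 ^ (K * w) := hfit x
    have h2 : K < 2 ^ Nat.size K := Nat.lt_size_self K
    have h3 : K * sz x ≤ 2 ^ Nat.size K * 2 ^ (K * w) := Nat.mul_le_mul h2.le h1.le
    have h4 : 2 ^ Nat.size K * 2 ^ (K * w) ≤ 2 ^ (G * w) := by
      rw [← pow_add]
      refine Nat.pow_le_pow_right (by norm_num) ?_
      rw [hG, Nat.add_mul]
      have : Nat.size K ≤ Nat.size K * w := Nat.le_mul_of_pos_right _ hw1
      omega
    omega
  obtain ⟨n2, n3, n4, n5, n6, n7, n8, n9, n10, n11, n12, n13⟩ :=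
    sim_numerics (Co := K) (k := k) (m := Program.maxConst M) (kB := kB)
      (mB := Program.maxConst MB) hw1 htG (length_lt_two_pow_inputWidth (A.encode x)) hc₁ hk'
  -- the (at most one) query: its answer is short and is computed by `M_B`
  have hO : ∀ q ∈ c.queries, (O q).length ≤ 2 ^ (c₁ * w) - 1 := fun q hq => by
    obtain ⟨y, rfl, -, -⟩ := hqs q hq
    have h1 := hBout y _ (hOans y)
    have h2 : K ≤ K * t + K := Nat.le_add_left _ _
    omega
  have hMB : ∀ q ∈ c.queries, ∃ cB, HaltsWithin MB (kB * inputWidth q) noOracle zeroCoins q (s q) cB ∧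
      readOut cB.mem = O q := fun q hq => by
    obtain ⟨y, rfl, -, -⟩ := hqs q hq
    exact (hOs y).2
  refine Inline.outputsWithin_SIM hdet hBdet hBof n2 n3 n4 n5 n6 n7 n8 n9 n10
    (Nat.le_add_left _ _) n11 hHalt n12 hO hMB noOracle zeroCoins (Nat.le_floor ?_)
  -- the cost, in `ℝ`
  set S : ℝ := (sz x : ℝ) with hSdef
  have hS1 : (1 : ℝ) ≤ S := by rw [hSdef]; exact_mod_cast hsz x
  have hS0 : (0 : ℝ) ≤ S := by linarith
  set P : ℝ := S ^ e with hPdef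
  have hP1 : 1 ≤ P := Real.one_le_rpow hS1 (by linarith)
  have hSP : S ≤ P := by
    have := Real.rpow_le_rpow_of_exponent_le hS1 he
    rwa [Real.rpow_one] at this
  have hK0 : (0 : ℝ) ≤ K := Nat.cast_nonneg _
  have hk'0 : (0 : ℝ) ≤ k' := Nat.cast_nonneg _
  -- the ingredients of the cost
  have hLr : (((A.encode x).length : ℕ) : ℝ) ≤ K * S := by rw [hSdef]; exact_mod_cast hL x
  have hsW : ((Nat.size (k' * w) : ℕ) : ℝ) ≤ k' * (K * S) := by
    have h1 : Nat.size (k' * w) ≤ k' * w := Nat.size_le.2 Nat.lt_two_pow_self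
    have h2 : k' * w ≤ k' * (K * sz x) := Nat.mul_le_mul_left _ (hwd x)
    rw [hSdef]; exact_mod_cast h1.trans h2
  have htr : (t : ℝ) ≤ K * S := by rw [hSdef]; exact_mod_cast ht
  have hℓ : (((readOut c.mem).length : ℕ) : ℝ) ≤ K := by exact_mod_cast hAout x _ hgood
  have hch : (((c.queries.map (Inline.charge (k' * w) O s)).sum : ℕ) : ℝ) ≤
      20 * (K * S) + 20 * (k' * (K * S)) + 38 * (CB' * ((K : ℝ) ^ e + 1) * P) + 16 * K + 77 := by
    have hRHS0 : (0 : ℝ) ≤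
        20 * (K * S) + 20 * (k' * (K * S)) + 38 * (CB' * ((K : ℝ) ^ e + 1) * P) + 16 * K + 77 := by
      positivity
    generalize hcq : c.queries = qs at hqlen hqs
    rcases qs with _ | ⟨q, _ | ⟨q', qs⟩⟩
    · simpa using hRHS0
    · obtain ⟨y, rfl, hy, hql⟩ := hqs q (by simp)
      simp only [List.map_cons, List.map_nil, List.sum_cons, List.sum_nil, add_zero, Inline.charge,
        Inline.qbCost]
      have hs1 : (s (B.encode y) : ℝ) ≤ CB' * (B.size y : ℝ) ^ e + CB' := by
        have h1 : (s (B.encode y) : ℝ) ≤ ((⌊CB * (B.size y : ℝ) ^ e + CB⌋₊ : ℕ) : ℝ) := by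
          exact_mod_cast (hOs y).1
        exact h1.trans (natFloor_affine_le (Real.rpow_nonneg (Nat.cast_nonneg _) _))
      have hme : (B.size y : ℝ) ^ e ≤ (K : ℝ) ^ e * P := by
        have hm : (B.size y : ℝ) ≤ K * S := by rw [hSdef]; exact_mod_cast hy
        calc (B.size y : ℝ) ^ e ≤ ((K : ℝ) * S) ^ e :=
              Real.rpow_le_rpow (Nat.cast_nonneg _) hm (by linarith)
          _ = (K : ℝ) ^ e * S ^ e := Real.mul_rpow hK0 hS0
      have hs2 : (s (B.encode y) : ℝ) ≤ CB' * ((K : ℝ) ^ e + 1) * P := by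
        have h1 := mul_le_mul_of_nonneg_left hme hCB'0
        have h2 : CB' ≤ CB' * P := le_mul_of_one_le_right hCB'0 hP1
        have h3 : CB' * ((K : ℝ) ^ e + 1) * P = CB' * ((K : ℝ) ^ e * P) + CB' * P := by ring
        linarith
      have hOq : (((O (B.encode y)).length : ℕ) : ℝ) ≤ K := by
        exact_mod_cast hBout y _ (hOans y)
      have hqlr : (((B.encode y).length : ℕ) : ℝ) ≤ K * S := by rw [hSdef]; exact_mod_cast hql
      push_cast
      linarith
    · simp at hqlen
  -- the total
  have hcost : ((Inline.simCost (A.encode x).length (k' * w) t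
      ((c.queries.map (Inline.charge (k' * w) O s)).sum) (readOut c.mem).length : ℕ) : ℝ) =
      20 * (((A.encode x).length : ℕ) : ℝ) + 20 * ((Nat.size (k' * w) : ℕ) : ℝ) + 275 + 38 * (t : ℝ) +
        (((c.queries.map (Inline.charge (k' * w) O s)).sum : ℕ) : ℝ) +
        (6 * (((readOut c.mem).length : ℕ) : ℝ) + 340) := by
    simp only [Inline.simCost, Inline.proCost, widthCost, Inline.epiCost, cstep]
    push_cast
    ring
  rw [hcost]
  have hKP : (K : ℝ) * S ≤ K * P := mul_le_mul_of_nonneg_left hSP hK0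
  have hk'KP : (k' : ℝ) * (K * S) ≤ k' * (K * P) := mul_le_mul_of_nonneg_left hKP hk'0
  have hK1 : (K : ℝ) ≤ K * P := le_mul_of_one_le_right hK0 hP1
  have hΓP : Γ * P = 100 * (K * P) + 40 * (k' * (K * P)) + 38 * (CB' * ((K : ℝ) ^ e + 1) * P) +
      692 * P := by rw [hΓ]; ring
  rw [hΓP]
  linarith

/-! ### The instance `A = OV`, size `(n+1)(d+1)` -/

/-- `(n+1)(d+1) < 2 ^ (3 · width)` for an `OV` input (`n, d < 2 ^ width`). [folklore] -/
theorem ov_area_lt_two_pow_width (I : OVInstance) : (I.n + 1) * (I.d + 1) < 2 ^ (3 * OV.width I) := by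
  change (I.n + 1) * (I.d + 1) < 2 ^ (3 * inputWidth (OV.encode I))
  set w := inputWidth (OV.encode I)
  have hw1 : 1 ≤ w := inputWidth_pos _
  have hn : I.n < 2 ^ w := lt_two_pow_inputWidth_of_mem _ _ (by rw [OV_encode_eq]; simp)
  have hd : I.d < 2 ^ w := lt_two_pow_inputWidth_of_mem _ _ (by rw [OV_encode_eq]; simp)
  calc (I.n + 1) * (I.d + 1) ≤ 2 ^ w * 2 ^ w := Nat.mul_le_mul hn hd
    _ < 2 ^ w * 2 ^ w * 2 ^ w := by
        have : 1 < 2 ^ w := Nat.one_lt_two_pow (by omega)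
        have h0 : 0 < 2 ^ w * 2 ^ w := by positivity
        nlinarith
    _ = 2 ^ (3 * w) := by rw [← pow_add, ← pow_add]; congr 1; omega

/-- `|OV.encode I| = 2 + 2nd ≤ 2 (n+1)(d+1)`. [folklore] -/
theorem length_OV_encode_le_area (I : OVInstance) : (OV.encode I).length ≤ 2 * ((I.n + 1) * (I.d + 1)) := by
  rw [length_OV_encode]; nlinarith

/-- The width of an `OV` input is at most `3 (n+1)(d+1)` (every word is `n`, `d` or a bit, and the
length is `2 + 2nd`). [folklore] -/
theorem OV_width_le_area (I : OVInstance) : OV.width I ≤ 3 * ((I.n + 1) * (I.d + 1)) := by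
  change inputWidth (OV.encode I) ≤ _
  unfold inputWidth
  refine (Nat.size_le.2 Nat.lt_two_pow_self).trans (max_le ?_ ?_)
  · rw [length_OV_encode]; nlinarith
  · refine foldr_max_one_le (by nlinarith) fun v hv => ?_
    refine (le_of_mem_OV_encode I hv).trans (max_le (by nlinarith) (max_le (by nlinarith) (by nlinarith)))

/-- Accepted outputs of `OV` are the single words `[1]` / `[0]`. [folklore] -/
theorem length_le_one_of_mem_OV_good (I : OVInstance) {out : List ℕ} (h : out ∈ OV.Good I) :
    out.length ≤ 1 := by
  change out ∈ (FGProblem.ofPred OVInstance.encode (·.n) OVInstance.HasOrthogonalPair).Good I at h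
  by_cases hp : I.HasOrthogonalPair
  · rw [FGProblem.ofPred_good_of_pos _ _ _ _ hp] at h
    rw [Set.mem_singleton_iff.1 h]; simp
  · rw [FGProblem.ofPred_good_of_neg _ _ _ _ hp] at h
    rw [Set.mem_singleton_iff.1 h]; simp

/-- **OV in time `O((n+1)^{2-ε} (d+1)²)` from a one-query reduction to a problem in time
`O(m^{2-ε})`** (Bringmann–Künnemann, FOCS 2015, proof of Thm. 3.3: "in time
`O(((n+m)d)^{2-ε}) = O((nd)^{2-ε})`"; Backurs–Indyk, STOC 2015, Thm. 3: "`d^{O(1)} · N^{2-δ}`").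
If a deterministic oracle program `M`, for every oracle answering `B`, decides every OV instance
`I` within `K (n+1)(d+1)` steps asking at most one query — a `B`-instance of size and length
`≤ K (n+1)(d+1)` — and accepted outputs of `B` have length `≤ K`, then a deterministic
`O(m^{2-ε})`-time word-RAM algorithm for `B` (`0 < ε ≤ 1`) gives `OVInTimePolyDim ε` (with dimension
exponent `2`): `((n+1)(d+1))^{2-ε} ≤ (n+1)^{2-ε} (d+1)²`. The same `ε`, as in print.
[cite: BringmannKunnemannFOCS2015, Thm. 3.3 (proof, §3.1)] [cite: BackursIndykSTOC2015, Thm. 3] -/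
theorem ovInTimePolyDim_of_oneQueryReduction {B : FGProblem} {M : Program} {k K : ℕ}
    (hdet : M.IsDeterministic) (hBout : ∀ y, ∀ out ∈ B.Good y, out.length ≤ K)
    (hred : ∀ O : List ℕ → List ℕ, B.OracleAnswers O → ∀ I : OVInstance,
      ∃ (c : Cfg) (t : ℕ), HaltsWithin M (k * OV.width I) O zeroCoins (OV.encode I) t c ∧
        t ≤ K * ((I.n + 1) * (I.d + 1)) ∧ readOut c.mem ∈ OV.Good I ∧ c.queries.length ≤ 1 ∧
        ∀ q ∈ c.queries, ∃ y : B.Inst, q = B.encode y ∧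
          B.size y ≤ K * ((I.n + 1) * (I.d + 1)) ∧ q.length ≤ K * ((I.n + 1) * (I.d + 1)))
    {ε : ℝ} (hε : 0 < ε) (hε1 : ε ≤ 1) (hB : B.InTimeO fun m => (m : ℝ) ^ (2 - ε)) :
    OVInTimePolyDim ε := by
  have hKK : ∀ S : ℕ, K * S ≤ (K + 3) * S := fun S => Nat.mul_le_mul_right _ (by omega)
  obtain ⟨C, hC⟩ := inTimeInst_rpow_of_oneQueryReduction (A := OV) (B := B) (K := K + 3)
    (fun I : OVInstance => (I.n + 1) * (I.d + 1)) hdet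
    (fun I => Nat.one_le_iff_ne_zero.2 (by positivity))
    (fun I => (ov_area_lt_two_pow_width I).trans_le
      (Nat.pow_le_pow_right (by norm_num) (Nat.mul_le_mul_right _ (by omega))))
    (fun I => (length_OV_encode_le_area I).trans (Nat.mul_le_mul_right _ (by omega)))
    (fun I => (OV_width_le_area I).trans (Nat.mul_le_mul_right _ (by omega)))
    (fun I out hout => (length_le_one_of_mem_OV_good I hout).trans (by omega))
    (fun y out hout => (hBout y out hout).trans (by omega))
    (fun O hO I => by
      obtain ⟨c, t, h1, h2, h3, h4, h5⟩ := hred O hO I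
      exact ⟨c, t, h1, h2.trans (hKK _), h3, h4, fun q hq => by
        obtain ⟨y, hy, hs, hl⟩ := h5 q hq
        exact ⟨y, hy, hs.trans (hKK _), hl.trans (hKK _)⟩⟩)
    (e := 2 - ε) (by linarith) hB
  refine ⟨max C 0, 2, hC.mono fun I => Nat.floor_le_floor ?_⟩
  -- `C ((n+1)(d+1))^{2-ε} ≤ max C 0 · (n+1)^{2-ε} (d+1)²`
  have hn1 : (1 : ℝ) ≤ (I.n : ℝ) + 1 := by linarith [I.n.cast_nonneg (α := ℝ)]
  have hd1 : (1 : ℝ) ≤ (I.d : ℝ) + 1 := by linarith [I.d.cast_nonneg (α := ℝ)]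
  have hT : ((((I.n + 1) * (I.d + 1) : ℕ) : ℝ)) = ((I.n : ℝ) + 1) * ((I.d : ℝ) + 1) := by
    push_cast; ring
  rw [hT]
  have hpow0 : (0 : ℝ) ≤ (((I.n : ℝ) + 1) * ((I.d : ℝ) + 1)) ^ (2 - ε) :=
    Real.rpow_nonneg (by positivity) _
  have h1 : (((I.n : ℝ) + 1) * ((I.d : ℝ) + 1)) ^ (2 - ε) ≤
      ((I.n : ℝ) + 1) ^ (2 - ε) * ((I.d : ℝ) + 1) ^ (2 : ℕ) := by
    rw [Real.mul_rpow (by linarith) (by linarith)]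
    refine mul_le_mul_of_nonneg_left ?_ (Real.rpow_nonneg (by linarith) _)
    rw [← Real.rpow_natCast]
    exact Real.rpow_le_rpow_of_exponent_le hd1 (by norm_num; exact hε.le)
  calc C * (((I.n : ℝ) + 1) * ((I.d : ℝ) + 1)) ^ (2 - ε)
      ≤ max C 0 * (((I.n : ℝ) + 1) * ((I.d : ℝ) + 1)) ^ (2 - ε) :=
        mul_le_mul_of_nonneg_right (le_max_left _ _) hpow0
    _ ≤ max C 0 * (((I.n : ℝ) + 1) ^ (2 - ε) * ((I.d : ℝ) + 1) ^ (2 : ℕ)) :=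
        mul_le_mul_of_nonneg_left h1 (le_max_right _ _)

end Literature.Computability.FineGrained
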